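import Summits.SmoothPoincare4.SmoothPoincare4.Theorems.SymplecticOrigamiGromovRecognitionRelEndGlueDefs
import Literature.Geometry.Symplectic.AlmostComplexStructure
import Literature.Geometry.Kaehler.ManifoldForms
import HarnessLib

/-!
# The data of ONE foliation of the wedge cap (line `cross-cap-laurent`, crux `GromovRecognitionRelEnd`,
item stmt-SmoothPoincare4-11009, stub `stub_coreGlue`)

The hypothesis structure `FoliationData` of the abstract open–closed argument producing ONE of the
two Gromov–McDuff fibrations of the wedge cap `X` (the `V`-fibration, whose leaves are the embedded
`JX`-spheres homotopic to the reference sphere `S₀ = (u₀, v₀) = V∞` and whose leaf space is the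
transverse wedge sphere `S_H = (uH, vH) = H∞`); the `H`-fibration is the SAME structure with the
roles of the two wedge spheres (and of the two holomorphic wedge coordinates `TH`, `TV`) exchanged.
It records exactly what the landed helpers of the line and the six vendored facts consume:

* the closed smooth 2-form `ωX` taming `JX` (energy, Gromov compactness);
* the reference sphere `S₀` (smooth `JX`-holomorphic two-chart pair, embedded, glued map `F₀`);
* the transverse wedge sphere `S_H` and the two `JX`-holomorphic wedge coordinates: `TH` on `UH`
  with zero set `im S_H`, `TV` on `UV` with zero set `im S₀`, both with COMPACT level sets
  `{T = t}` for `‖t‖ < δ`;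
* the intersection numbers: `S₀` meets every flat `H`-leaf `{TH = t}` exactly once (count `1`),
  and misses `UH` at `u₀ 0`;
* the corner `vH 0 = v₀ 0`, the only common point of the two wedge spheres;
* `π₂` off the wedge: a `JX`-sphere missing both wedge spheres is constant;
* each punctured wedge sphere is contractible in `X` (maps of `ℂℙ¹` into it are null-homotopic).

All clauses are discharged for the concrete cap of `stub_capModel` by landed helpers
(`helper_wedgeSphere{H,V}`, `helper_wedgeSphereEmb{V,H}`, `helper_wedgeCoordinate{H,V}`,
`helper_wedgeCoordinateDerivNeZero`, `helper_wedgeLevel{SetH,CompactH}`, `helper_vinfSphereHCount`,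
`helper_vinfLevelHCount`, `helper_offWedgeMemRange` + `helper_noJSpheresInImage`,
`helper_wedgeAxisNullHomotopic{H,V}`, `stub_wedgeDisjoint`).
-/

noncomputable section

open scoped Manifold ContDiff Topology
open Set Function Literature.Topology.FourManifolds Literature.Topology.FourManifolds.ComplexProjectiveSpace
  Literature.Geometry.Kaehler Literature.Geometry.Symplectic

-- the prescribed namespace `Summit.<P>.<Sub>.…` duplicates `SmoothPoincare4` (P = Sub)
set_option linter.dupNamespace false

namespace Summit.SmoothPoincare4.SmoothPoincare4.Theorems.GromovRecognitionRelEnd.CrossCapLaurent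

variable {X : Type} [TopologicalSpace X] [ChartedSpace (EuclideanSpace ℝ (Fin 4)) X]
  [IsManifold (𝓡 4) ∞ X]

/-- **The data of one foliation of the wedge cap** (see the module docstring): taming form,
reference sphere `S₀ = (u₀, v₀)` with glued map `F₀`, transverse wedge sphere `S_H = (uH, vH)`,
holomorphic wedge coordinates `TH` on `UH` (zero set `im S_H`) and `TV` on `UV` (zero set `im S₀`)
with compact small levels, the count `S₀ · {TH = t} = 1`, the corner, `π₂` off the wedge, and
contractibility of the punctured wedge spheres. [folklore] -/
@[folklore]
structure FoliationData (ωX : MForm (𝓡 4) X ℝ 2) (JX : AlmostComplexStructure (𝓡 4) ∞ X)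
    (u₀ v₀ uH vH : ℂ → X) (F₀ : C(ComplexProjectiveSpace 1, X)) (TH TV : X → ℂ) (UH UV : Set X)
    (δ : ℝ) : Prop where
  /-- `ωX` is smooth -/
  smoothForm : IsSmoothForm ωX
  /-- `ωX` is closed -/
  closedForm : IsClosedForm ωX
  /-- `ωX` tames `JX` -/
  tamed : JX.IsTamedBy ωX
  /-- the reference sphere is a smooth `JX`-holomorphic two-chart pair -/
  ref_sphere : TwoChartSphere (fun y => JX y) u₀ v₀
  /-- the reference sphere is embedded -/
  ref_embedded : IsEmbeddedPair u₀ v₀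
  /-- `F₀` is the glued map of the reference sphere -/
  ref_glued : IsGlued F₀ u₀ v₀
  /-- the transverse wedge sphere is a smooth `JX`-holomorphic two-chart pair -/
  wedge_sphere : TwoChartSphere (fun y => JX y) uH vH
  /-- `TH` is a holomorphic coordinate on `UH` -/
  coordH : IsHolCoordinate (fun y => JX y) TH UH
  /-- `TV` is a holomorphic coordinate on `UV` -/
  coordV : IsHolCoordinate (fun y => JX y) TV UV
  /-- the zero set of `TH` is the transverse wedge sphere -/
  zeroSetH : {y | y ∈ UH ∧ TH y = 0} = pairImage uH vH
  /-- the zero set of `TV` is the reference sphere -/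
  zeroSetV : {y | y ∈ UV ∧ TV y = 0} = pairImage u₀ v₀
  /-- small levels of `TH` are compact -/
  levelsH : ∀ t : ℂ, ‖t‖ < δ → IsCompact {y | y ∈ UH ∧ TH y = t}
  /-- small levels of `TV` are compact -/
  levelsV : ∀ s : ℂ, ‖s‖ < δ → IsCompact {y | y ∈ UV ∧ TV y = s}
  /-- `δ` is positive -/
  δ_pos : 0 < δ
  /-- the reference sphere meets every small `H`-level exactly once -/
  count_ref : ∀ t : ℂ, ‖t‖ < δ → wedgeCount (fun y => TH y - t) UH u₀ v₀ = 1
  /-- the reference sphere misses `UH` at `z = 0` -/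
  ref_off : u₀ 0 ∉ UH
  /-- the corner -/
  corner : vH 0 = v₀ 0
  /-- the two wedge spheres meet only at the corner -/
  inter_eq : pairImage uH vH ∩ pairImage u₀ v₀ = {v₀ 0}
  /-- `π₂` off the wedge: a `JX`-sphere missing both wedge spheres is constant -/
  pi2 : ∀ u v : ℂ → X, TwoChartSphere (fun y => JX y) u v →
    (∀ z, u z ∉ pairImage uH vH ∪ pairImage u₀ v₀) → v 0 ∉ pairImage uH vH ∪ pairImage u₀ v₀ →
    ∀ z, u z = u 0
  /-- the punctured transverse wedge sphere is contractible in `X` -/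
  nullH : ∀ G : C(ComplexProjectiveSpace 1, X), Set.range G ⊆ pairImage uH vH \ {v₀ 0} →
    ∃ y : X, G.Homotopic (ContinuousMap.const _ y)
  /-- the punctured reference sphere is contractible in `X` -/
  nullV : ∀ G : C(ComplexProjectiveSpace 1, X), Set.range G ⊆ pairImage u₀ v₀ \ {v₀ 0} →
    ∃ y : X, G.Homotopic (ContinuousMap.const _ y)

/-- The foliation data are SYMMETRIC: exchanging the reference sphere with the transverse wedge
sphere (and `TH` with `TV`) gives foliation data again, granted the mirrored count, the mirrored
`ref_off` clause and a glued map of the wedge sphere. (This is how the `H`-fibration is obtained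
from the `V`-fibration theorem.) [folklore] -/
theorem helper_foliationData_symm : ∀ (ωX : MForm (𝓡 4) X ℝ 2)
    (JX : AlmostComplexStructure (𝓡 4) ∞ X) (u₀ v₀ uH vH : ℂ → X)
    (F₀ FH : C(ComplexProjectiveSpace 1, X)) (TH TV : X → ℂ) (UH UV : Set X) (δ : ℝ),
    FoliationData ωX JX u₀ v₀ uH vH F₀ TH TV UH UV δ →
    IsEmbeddedPair uH vH → IsGlued FH uH vH →
    (∀ s : ℂ, ‖s‖ < δ → wedgeCount (fun y => TV y - s) UV uH vH = 1) → uH 0 ∉ UV →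
    FoliationData ωX JX uH vH u₀ v₀ FH TV TH UV UH δ := by
  intro ωX JX u₀ v₀ uH vH F₀ FH TH TV UH UV δ D hemb hgl hcount hoff
  have hinter : pairImage u₀ v₀ ∩ pairImage uH vH = {vH 0} := by
    rw [Set.inter_comm, D.corner]; exact D.inter_eq
  refine
    { smoothForm := D.smoothForm
      closedForm := D.closedForm
      tamed := D.tamed
      ref_sphere := D.wedge_sphere
      ref_embedded := hemb
      ref_glued := hgl
      wedge_sphere := D.ref_sphere
      coordH := D.coordV
      coordV := D.coordH
      zeroSetH := D.zeroSetV
      zeroSetV := D.zeroSetH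
      levelsH := D.levelsV
      levelsV := D.levelsH
      δ_pos := D.δ_pos
      count_ref := hcount
      ref_off := hoff
      corner := D.corner.symm
      inter_eq := hinter
      pi2 := fun u v huv hu hv => D.pi2 u v huv (fun z h => hu z (by rwa [Set.union_comm]))
        (fun h => hv (by rwa [Set.union_comm]))
      nullH := fun G hG => D.nullV G (by rwa [← D.corner])
      nullV := fun G hG => D.nullH G (by rwa [← D.corner]) }

end Summit.SmoothPoincare4.SmoothPoincare4.Theorems.GromovRecognitionRelEnd.CrossCapLaurent

end
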